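import Mathlib

/-!
# NE7PairwiseTower — row NE7 (node U5), route «PAIR-CAUCHY»: NODE T♭ — null two-run MODULI compose along the tower
# (creation defect + background-Lipschitz × gauge modulus + fading-memory history term + marginal discrepancy), the
# history term being a GEOMETRIC CONVOLUTION of a null sequence, hence null (Tannery)

Cell `pub-balaban`, rung (B)+1 sub-cell t4, lineage `b2b-balaban-t4-ne7-p2` (CRUX PROVER NE7 #2 under the coordinator
ruling «YM redirect», 2026-08-21; generation 48; route text `HOME/t4/b2b-balaban-t4-ne7-p2/g48/ROUTE2-NE7-P2.md` §2,
NODE T♭ and §5 step 1).  Companion of `Support/NE7PairwiseCauchy` (p247800), `Support/NE7PairwiseMarginal` (p248053).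
HONEST FRAMING (page 1): FIXED FINITE T⁴, rung (B)+1, CONDITIONAL on BetaPertH and the nine spine estimates (0/9 proved);
NOT infinite volume, NOT a mass gap, NOT the Clay problem.  NE7 is NOT PRINTED in [Balaban1984PropagatorsI]–
[Balaban1989LargeFieldII] and NOT proved here.  [folklore] real analysis on hypothesis shapes (abstract double sequences);
no definition, no cite tag, nothing printed asserted, no `sorry`.

WHY.  Road P1's NODE T composes GEOMETRIC node rates into the tower rate `URateUpTo K` with one K-uniform constant
(`T4TowerRateDischarge.uRateUpTo_of_nodes`: NE9's history Lipschitz moduli with `FadingMemory ω`, `LipBackground` × row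
NE3's `LocalRate θ₃` through `GaugeDominated`, row NE5's creation rate `θ₅`, node U2's `InjectedRate θc`; common rate
`θ′ > max(ω, θc, θ₃, θ₅)`).  On the route «PAIR-CAUCHY» the same composition is needed with NULL MODULI in place of
rates: the two-run discrepancy of a term born at block scale `m` (age `K − m`), read for the pair of runs `K ≤ K′`, is
bounded by (creation defect at equal arguments: row NE5♭) + (background-Lipschitz constant × gauge discrepancy of the
synchronised backgrounds: T.2 × row NE3♭) + (history term: NE9's moduli `C₉·ν^n` against the discrepancies of the `n`-th
earlier inputs — couplings and activities at the finer scales `m + n`) + (coupling discrepancy: (M♭),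
`NE7PairwiseMarginal.marginal_tendsto_zero`).  The only non-trivial composition step is the HISTORY TERM: a geometric
convolution `Σ_{n ≤ a} ν^n·u(a − n)` of the memory weights with a bounded null sequence `u` (indexed by the age) is
again null — dominated convergence for series.  Everything else is finite linear combination of null sequences.  The
memory RATIO `ν < 1` stays geometric: it is a ONE-run structural constant of the history channel (kernel-derived on row
NE4's transfer model from printed-type leaves), not a two-run rate.

WHAT IS PROVED ([folklore]).
§1 **`tendsto_geomConv`** — `0 ≤ ν < 1`, `|u a| ≤ U`, `u → 0` ⟹ `(a ↦ Σ_{n ≤ a} ν^n·u (a − n)) → 0`; `geomConv_le`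
   (the uniform bound `U∕(1−ν)`).
§2 **`termModulus_tendsto_zero`** — NODE T♭ displayed: if at every scale `m` the term discrepancy of the pair indexed by
   `K` obeys `T K m ≤ ω₅ K m + CU·ω₃ K m + C₉·Σ_{n ≤ K−m} ν^n·h K (m, n) + Cd·d K m` with every input null in `K` at fixed
   `m` (the history input in the convolution form of §1: `h K (m, n) = u m (K − m − n)` with `u m` bounded and null in
   the age), then `T K m → 0` for every `m`; `termModulus_bound` (the K-uniform bound from the inputs' bounds).
§3 `toy_tower` — non-vacuity.

NOT DELIVERED: the instance over road P1's sockets (`URateUpTo`'s data) — under the freeze no modulus-variants of the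
socket PREDICATES are declared; the composition is stated over abstract double sequences and is applied by whoever
instantiates NODE O.  NOT NE7 (spine 0/9 unchanged), NOT summit progress.  HONEST DEPENDENCY: continuum YM on T⁴ ⇐
BetaPertH ∧ nine spine estimates (0/9 proved); BetaPertH ⇐ (D1) ∧ (D4) ∧ CAP+tail; G-an2-4 gates asym, D1 and NE2/3/4.
-/

noncomputable section

open Finset Filter Topology
open scoped BigOperators

namespace Summit.QuantumFields.BalabanUV.T4Continuum.NE7PairwiseTower

/-! ## §1 A geometric convolution of a bounded null sequence is null -/

section Conv

variable {ν U : ℝ} {u : ℕ → ℝ}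

/-- The uniform bound: `|Σ_{n ≤ a} ν^n·u (a − n)| ≤ U∕(1−ν)` for `0 ≤ ν < 1`, `|u| ≤ U`. [folklore] -/
theorem geomConv_le (hν0 : 0 ≤ ν) (hν1 : ν < 1) (hU : ∀ a, |u a| ≤ U) (a : ℕ) :
    |∑ n ∈ range (a + 1), ν ^ n * u (a - n)| ≤ U / (1 - ν) := by
  have hU0 : 0 ≤ U := le_trans (abs_nonneg _) (hU 0)
  have hs := summable_geometric_of_lt_one hν0 hν1
  calc |∑ n ∈ range (a + 1), ν ^ n * u (a - n)| ≤ ∑ n ∈ range (a + 1), |ν ^ n * u (a - n)| := abs_sum_le_sum_abs _ _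
    _ ≤ ∑ n ∈ range (a + 1), ν ^ n * U := by
        refine sum_le_sum fun n _ => ?_
        rw [abs_mul, abs_of_nonneg (pow_nonneg hν0 n)]
        exact mul_le_mul_of_nonneg_left (hU _) (pow_nonneg hν0 n)
    _ = (∑ n ∈ range (a + 1), ν ^ n) * U := by rw [sum_mul]
    _ ≤ (1 - ν)⁻¹ * U := by
        refine mul_le_mul_of_nonneg_right ?_ hU0
        rw [← tsum_geometric_of_lt_one hν0 hν1]
        exact hs.sum_le_tsum _ fun i _ => pow_nonneg hν0 i
    _ = U / (1 - ν) := by rw [div_eq_inv_mul]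

/-- **A GEOMETRIC CONVOLUTION OF A BOUNDED NULL SEQUENCE IS NULL.**  `0 ≤ ν < 1`, `|u a| ≤ U`, `u a → 0` ⟹
`Σ_{n ≤ a} ν^n·u (a − n) → 0` (`a → ∞`).  Tannery: the `n`-th summand is dominated by `U·ν^n` (summable) and tends to
`0` because `a − n → ∞`. [folklore] -/
theorem tendsto_geomConv (hν0 : 0 ≤ ν) (hν1 : ν < 1) (hU : ∀ a, |u a| ≤ U) (hu : Tendsto u atTop (𝓝 0)) :
    Tendsto (fun a => ∑ n ∈ range (a + 1), ν ^ n * u (a - n)) atTop (𝓝 0) := by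
  let f : ℕ → ℕ → ℝ := fun a n => if n ≤ a then ν ^ n * u (a - n) else 0
  have hf_eq : ∀ a, ∑ n ∈ range (a + 1), ν ^ n * u (a - n) = ∑' n, f a n := by
    intro a
    rw [tsum_eq_sum (s := range (a + 1))]
    · refine sum_congr rfl fun n hn => ?_
      simp only [f, if_pos (Nat.lt_succ_iff.1 (mem_range.1 hn))]
    · intro n hn
      simp only [f, if_neg (fun h => hn (mem_range.2 (Nat.lt_succ_iff.2 h)))]
  have hU0 : 0 ≤ U := le_trans (abs_nonneg _) (hU 0)
  have hlim : ∀ n, Tendsto (fun a => f a n) atTop (𝓝 0) := by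
    intro n
    have hun : Tendsto (fun a => ν ^ n * u (a - n)) atTop (𝓝 0) := by
      simpa using (hu.comp (tendsto_sub_atTop_nat n)).const_mul (ν ^ n)
    refine hun.congr' ?_
    filter_upwards [eventually_ge_atTop n] with a ha
    simp only [f, if_pos ha]
  have hbd : ∀ᶠ a in atTop, ∀ n, ‖f a n‖ ≤ U * ν ^ n := Eventually.of_forall fun a n => by
    by_cases h : n ≤ a
    · simp only [f, if_pos h, Real.norm_eq_abs, abs_mul, abs_of_nonneg (pow_nonneg hν0 n)]
      rw [mul_comm]
      exact mul_le_mul_of_nonneg_right (hU _) (pow_nonneg hν0 n)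
    · simp only [f, if_neg h, norm_zero]; positivity
  have hsum : Summable fun n => U * ν ^ n := (summable_geometric_of_lt_one hν0 hν1).mul_left U
  have h := tendsto_tsum_of_dominated_convergence hsum hlim hbd
  simp only [tsum_zero] at h
  exact h.congr fun a => (hf_eq a).symm

end Conv

/-! ## §2 NODE T♭: the term modulus is a finite combination of null inputs -/

section Tower

variable {ν CU C₉ Cd U : ℝ} {T ω₅ ω₃ d : ℕ → ℕ → ℝ} {u : ℕ → ℕ → ℝ}

/-- **NODE T♭ — THE TERM MODULUS TENDS TO ZERO.**  For the pair of runs indexed by `K` and a term born at block scale `m`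
(age `K − m`): if the two-run term discrepancy is bounded by the CREATION defect `ω₅ K m` (row NE5♭), the background
channel `CU·ω₃ K m` (T.2's Lipschitz constant × row NE3♭'s gauge modulus), the HISTORY channel
`C₉·Σ_{n ≤ K−m} ν^n·u m (K − m − n)` (row NE9's memory weights against the discrepancies of the inputs `n` scales finer,
written as a function `u m` of their age, bounded by `U` and null) and the MARGINAL channel `Cd·d K m` ((M♭)), each null in
`K` at fixed `m`, then `T K m → 0` for every `m`. [folklore] -/
theorem termModulus_tendsto_zero (hν0 : 0 ≤ ν) (hν1 : ν < 1)
    (hT : ∀ K m, m ≤ K → T K m ≤ ω₅ K m + CU * ω₃ K m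
      + C₉ * ∑ n ∈ range (K - m + 1), ν ^ n * u m (K - m - n) + Cd * d K m)
    (hT0 : ∀ K m, 0 ≤ T K m)
    (h5 : ∀ m, Tendsto (fun K => ω₅ K m) atTop (𝓝 0)) (h3 : ∀ m, Tendsto (fun K => ω₃ K m) atTop (𝓝 0))
    (hu : ∀ m a, |u m a| ≤ U) (hu0 : ∀ m, Tendsto (u m) atTop (𝓝 0))
    (hd : ∀ m, Tendsto (fun K => d K m) atTop (𝓝 0)) :
    ∀ m, Tendsto (fun K => T K m) atTop (𝓝 0) := by
  intro m
  -- the history channel, re-indexed by the age `a = K − m`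
  have hconv : Tendsto (fun K => ∑ n ∈ range (K - m + 1), ν ^ n * u m (K - m - n)) atTop (𝓝 0) :=
    (tendsto_geomConv hν0 hν1 (hu m) (hu0 m)).comp (tendsto_sub_atTop_nat m)
  have hmaj : Tendsto (fun K => ω₅ K m + CU * ω₃ K m
      + C₉ * ∑ n ∈ range (K - m + 1), ν ^ n * u m (K - m - n) + Cd * d K m) atTop (𝓝 0) := by
    have := (((h5 m).add ((h3 m).const_mul CU)).add (hconv.const_mul C₉)).add ((hd m).const_mul Cd)
    simpa using this
  refine squeeze_zero' (Eventually.of_forall fun K => hT0 K m) ?_ hmaj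
  filter_upwards [eventually_ge_atTop m] with K hK
  exact hT K m hK

/-- The K-uniform bound that goes with it: inputs bounded by `B₅, B₃, U, Bd` give
`T K m ≤ B₅ + |CU|·B₃ + |C₉|·U∕(1−ν) + |Cd|·Bd`. [folklore] -/
theorem termModulus_bound (hν0 : 0 ≤ ν) (hν1 : ν < 1) {B₅ B₃ Bd : ℝ}
    (hT : ∀ K m, m ≤ K → T K m ≤ ω₅ K m + CU * ω₃ K m
      + C₉ * ∑ n ∈ range (K - m + 1), ν ^ n * u m (K - m - n) + Cd * d K m)
    (h5 : ∀ K m, |ω₅ K m| ≤ B₅) (h3 : ∀ K m, |ω₃ K m| ≤ B₃) (hu : ∀ m a, |u m a| ≤ U) (hd : ∀ K m, |d K m| ≤ Bd) :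
    ∀ K m, m ≤ K → T K m ≤ B₅ + |CU| * B₃ + |C₉| * (U / (1 - ν)) + |Cd| * Bd := by
  intro K m hm
  refine (hT K m hm).trans ?_
  have e1 : ω₅ K m ≤ B₅ := le_trans (le_abs_self _) (h5 K m)
  have e2 : CU * ω₃ K m ≤ |CU| * B₃ := by
    calc CU * ω₃ K m ≤ |CU * ω₃ K m| := le_abs_self _
      _ = |CU| * |ω₃ K m| := abs_mul _ _
      _ ≤ |CU| * B₃ := mul_le_mul_of_nonneg_left (h3 K m) (abs_nonneg _)
  have e3 : C₉ * ∑ n ∈ range (K - m + 1), ν ^ n * u m (K - m - n) ≤ |C₉| * (U / (1 - ν)) := by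
    calc C₉ * ∑ n ∈ range (K - m + 1), ν ^ n * u m (K - m - n)
        ≤ |C₉ * ∑ n ∈ range (K - m + 1), ν ^ n * u m (K - m - n)| := le_abs_self _
      _ = |C₉| * |∑ n ∈ range (K - m + 1), ν ^ n * u m (K - m - n)| := abs_mul _ _
      _ ≤ |C₉| * (U / (1 - ν)) := mul_le_mul_of_nonneg_left (geomConv_le hν0 hν1 (hu m) _) (abs_nonneg _)
  have e4 : Cd * d K m ≤ |Cd| * Bd := by
    calc Cd * d K m ≤ |Cd * d K m| := le_abs_self _
      _ = |Cd| * |d K m| := abs_mul _ _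
      _ ≤ |Cd| * Bd := mul_le_mul_of_nonneg_left (hd K m) (abs_nonneg _)
  linarith

end Tower

/-! ## §3 Non-vacuity -/

section Toy

/-- All inputs `1∕(K+1)`-type (null, bounded by `1`), memory `ν = 1∕2`, history input `u m a = 1∕(a+1)`: the term
modulus `T K m := ω₅ + ω₃ + Σ + d` itself satisfies the hypothesis with equality-type bound and tends to `0`. [folklore] -/
theorem toy_tower :
    let u : ℕ → ℕ → ℝ := fun _ a => 1 / (a + 1)
    let w : ℕ → ℕ → ℝ := fun K _ => 1 / (K + 1)
    let T : ℕ → ℕ → ℝ := fun K m => w K m + 1 * w K m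
      + 1 * ∑ n ∈ range (K - m + 1), (1 / 2 : ℝ) ^ n * u m (K - m - n) + 1 * w K m
    ∀ m, Tendsto (fun K => T K m) atTop (𝓝 0) := by
  intro u w T
  refine termModulus_tendsto_zero (ν := 1 / 2) (CU := 1) (C₉ := 1) (Cd := 1) (U := 1) (ω₅ := w) (ω₃ := w) (d := w)
    (u := u) (by norm_num) (by norm_num) (fun K m _ => le_rfl) ?_ ?_ ?_ ?_ ?_ ?_
  · intro K m
    have h1 : 0 ≤ w K m := by simp only [w]; positivity
    have h2 : 0 ≤ ∑ n ∈ range (K - m + 1), (1 / 2 : ℝ) ^ n * u m (K - m - n) :=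
      sum_nonneg fun n _ => mul_nonneg (by positivity) (by simp only [u]; positivity)
    simp only [T]
    linarith
  · exact fun m => tendsto_one_div_add_atTop_nhds_zero_nat
  · exact fun m => tendsto_one_div_add_atTop_nhds_zero_nat
  · intro m a
    simp only [u]
    rw [abs_of_nonneg (by positivity)]
    rw [div_le_one (by positivity)]
    have : (0 : ℝ) ≤ a := Nat.cast_nonneg a
    linarith
  · exact fun m => tendsto_one_div_add_atTop_nhds_zero_nat
  · exact fun m => tendsto_one_div_add_atTop_nhds_zero_nat

end Toy

end Summit.QuantumFields.BalabanUV.T4Continuum.NE7PairwiseTower
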